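import Literature.NumberTheory.GaloisRepresentations.NeukirchLocalEmbeddingNF
import HarnessLib

/-!
# The local-type axioms of Neukirch's lemma at `D_A ∩ W ≤ Γ_K`, `K` a number field

Topic `NumberTheory/GaloisRepresentations`; namespace
`Literature.NumberTheory.GaloisRepresentations.ExplicitMuCocycles`.  Proof file: theorems only (no
definition, no instance, no named fact).  Classical algebraic number theory: the NUMBER-FIELD
INSTANCES of the four D-side ("local type") hypotheses (AxLn), (AxD), (AxLv), (AxLi) of
abc-iut-w5-d055's abstract Neukirch theorem `NeukirchAbstract.exists_prime_smul_eq_of_localType`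
([NSW] Prop. (12.1.9): a closed subgroup of `Γ_K` of local type lies in a decomposition group;
abc-iut GAP-LEDGER row G-L4d2g4-1, campaign L), in the SHAPES of the holder's spec
`HOME/staging/w5/w5-d055/g7/NF-AXIOM-SPEC.md`.

SETTING.  `K : Type` a number field, `Γ := Field.absoluteGaloisGroup K`, `R := ZMod ℓ` (`ℓ` prime),
a nonarchimedean prime of `K̄` = a valuation subring `A ≠ ⊤` of `K̄ = AlgebraicClosure K`, its
decomposition group `D_A := MulAction.stabilizer Γ A`, `W' ≤ W ≤ Γ` open subgroups with `W` acting
trivially on `μ_ℓ(K̄)` (`hWμ : ∀ σ ∈ W, ∀ z : MuCarrier K ℓ, mu K ℓ σ z = z`), cochains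
`f : Γ → Γ → ZMod ℓ` read on `S := D_A ⊓ W` (locally constant on `S × S`, cocycle / coboundary
identities quantified over `S`, the conventions of `NeukirchAbstractUniqueness.lean`).

THE PROOFS move explicit cochains between `φ⁻¹(W) ≤ Γ_{K_v}` and `D_A ∩ W ≤ Γ_K` along the local
embedding `φ = σ · res_v(·) · σ⁻¹` of `NeukirchLocalEmbeddingNF.lean` (pull back = compose with `φ`,
push forward = `LocallyConstantCochainTransport.lean`), the local mathematics being the holder's
`NeukirchLocalAxiomsGalFixing.lean` at the subgroups `Gal(F̄_v/M) = galFixing K_v M ≤ Γ_{K_v}`: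

* **`axLn_stabilizer_inf`** — (AxLn) `H²(D_A ∩ W, ℤ/ℓ) ≠ 0`;
* **`axD_stabilizer_inf`** — (AxD) `dim H²(D_A ∩ W, ℤ/ℓ) ≤ 1`;
* **`axLv_stabilizer_inf`** — (AxLv) restriction to `D_A ∩ W'` kills `H²(D_A ∩ W)` when
  `ℓ ∣ [D_A ∩ W : D_A ∩ W']`;
* **`axLi_stabilizer_inf`** — (AxLi) restriction to `D_A ∩ W'` is injective on `H²(D_A ∩ W)` when
  `ℓ ∤ [D_A ∩ W : D_A ∩ W']`.

HONEST FRAMING: classical (Serre *Local Fields* XIII §3, [NSW] VII/XII); nothing here bears on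
[IUTchIII] Cor. 3.12; no side taken.

## References

* J. Neukirch, A. Schmidt, K. Wingberg, *Cohomology of Number Fields* (2nd ed. 2008), XII §1
  Prop. (12.1.9). [NeukirchSchmidtWingberg2008]
* J.-P. Serre, *Local Fields* (1979), XIII §3. [SerreLocalFields1979]
* J.-P. Serre, *Galois Cohomology* (1997), I §2.4. [SerreGaloisCohomology1997]
-/

noncomputable section

open scoped NumberField Pointwise
open Field IsDedekindDomain Function

namespace Literature.NumberTheory.GaloisRepresentations.ExplicitMuCocycles

open Literature.NumberTheory.GaloisRepresentations
open Literature.NumberTheory.GaloisRepresentations.LocalWeilDatum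
open Literature.GroupTheory.LocallyConstantCocycles
open Literature.AnabelianGeometry.AbsoluteAnabelian (decompositionGroupNF
  exists_ideal_mem_primesAbove_of_ne_top decompositionGroupNF_eq_decompositionSubgroup
  decompositionGroupNF_eq_stabilizer exists_intermediateField_of_isOpen_absoluteGaloisGroup)
open DiscreteGaloisModule

variable (K : Type) [Field K] [NumberField K]

/-! ### The four local-type axioms at `D_A ∩ W` -/

section Axioms

variable {ℓ : ℕ} [hℓ : Fact ℓ.Prime]

/-- **(AxLn) at `D_A ∩ W`**: for a nontrivial valuation subring `A` of `K̄` and an open `W ≤ Γ_K`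
fixing `μ_ℓ(K̄)`, there is an explicit `ℤ/ℓ`-valued locally constant `2`-cocycle on `D_A ∩ W` which
is not a coboundary there — `H²(D_A ∩ W, ℤ/ℓ) ≠ 0` (`D_A ∩ W ≅ Gal(\bar K_v/M)`, `M ∋ ζ_ℓ` finite
over `K_v`; Serre *Local Fields* XIII §3). [cite: NeukirchSchmidtWingberg2008, XII §1 (12.1.9)] -/
theorem axLn_stabilizer_inf (A : ValuationSubring (AlgebraicClosure K)) (hA : A ≠ ⊤)
    (W : Subgroup (absoluteGaloisGroup K)) (hW : IsOpen (W : Set (absoluteGaloisGroup K)))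
    (hWμ : ∀ σ ∈ W, ∀ z : MuCarrier K ℓ, mu K ℓ σ z = z) :
    ∃ f : absoluteGaloisGroup K → absoluteGaloisGroup K → ZMod ℓ,
      IsLocallyConstant
          (fun q : ↥(MulAction.stabilizer (absoluteGaloisGroup K) A ⊓ W) ×
            ↥(MulAction.stabilizer (absoluteGaloisGroup K) A ⊓ W) => f q.1 q.2) ∧
      (∀ a ∈ MulAction.stabilizer (absoluteGaloisGroup K) A ⊓ W,
        ∀ b ∈ MulAction.stabilizer (absoluteGaloisGroup K) A ⊓ W,
        ∀ c ∈ MulAction.stabilizer (absoluteGaloisGroup K) A ⊓ W,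
          f a b + f (a * b) c = f b c + f a (b * c)) ∧
      ¬ ∃ β : absoluteGaloisGroup K → ZMod ℓ,
        IsLocallyConstant (fun s : ↥(MulAction.stabilizer (absoluteGaloisGroup K) A ⊓ W) => β s) ∧
          ∀ a ∈ MulAction.stabilizer (absoluteGaloisGroup K) A ⊓ W,
            ∀ b ∈ MulAction.stabilizer (absoluteGaloisGroup K) A ⊓ W,
              f a b = β a + β b - β (a * b) := by
  obtain ⟨v, σ, φ, hinj, hcont, hrange, hφι⟩ := exists_localEmbedding K A hA
  haveI : CharZero (v.adicCompletion K) := LocalField.charZero_adicCompletion v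
  obtain ⟨M, hMfin, hMU⟩ := exists_galFixing_eq_comap hcont W hW
  haveI := hMfin
  obtain ⟨e, he⟩ := exists_continuousMulEquiv_comap hinj hcont hrange W hW
  have hM : ∀ u ∈ galFixing (v.adicCompletion K) M, ∀ z : MuCarrier (v.adicCompletion K) ℓ,
      mu (v.adicCompletion K) ℓ u z = z := by
    rw [hMU]; exact mu_apply_eq_self_comap hφι W hWμ
  -- the local axiom on `Gal(\bar K_v / M) = φ⁻¹(W)`
  obtain ⟨fG, hfGlc, hfGcoc, hfG⟩ := exists_explicit_not_coboundary (v.adicCompletion K) M hM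
  rw [hMU] at hfGlc hfGcoc hfG
  -- push forward along `e`
  obtain ⟨f, hflc, hfcoc, hfe⟩ := exists_cochainOn_of_cochain
    (MulAction.stabilizer (absoluteGaloisGroup K) A ⊓ W) e (fun a b : ↥(W.comap φ) => fG a b) hfGlc
    (fun a b c => by
      have := hfGcoc _ a.2 _ b.2 _ c.2
      rwa [← Subgroup.coe_mul, ← Subgroup.coe_mul] at this)
  refine ⟨f, hflc, hfcoc, ?_⟩
  rintro ⟨β, hβ, hcob⟩
  refine hfG ⟨fun y => β (φ y), ?_, fun a ha b hb => ?_⟩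
  · have heq : (fun s : ↥(W.comap φ) => β (φ s)) =
        (fun t : ↥(MulAction.stabilizer (absoluteGaloisGroup K) A ⊓ W) => β t) ∘ e := by
      funext s; simp only [Function.comp_apply, he]
    rw [heq]
    exact hβ.comp_continuous e.continuous
  · show fG a b = β (φ a) + β (φ b) - β (φ (a * b))
    have h1 := hfe ⟨a, ha⟩ ⟨b, hb⟩
    rw [he, he] at h1
    rw [← h1, map_mul]
    exact hcob _ (map_mem_stabilizer_inf K hrange ha) _ (map_mem_stabilizer_inf K hrange hb)

/-- **(AxD) at `D_A ∩ W`**: with `A`, `W` as in `axLn_stabilizer_inf`, if `f` is an explicit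
cocycle on `D_A ∩ W` which does not bound there, every explicit cocycle `g` on `D_A ∩ W` satisfies
`g - c f ∼ 0` on `D_A ∩ W` for some `c ∈ ℤ/ℓ` — `dim H²(D_A ∩ W, ℤ/ℓ) ≤ 1` (Serre *Local Fields*
XIII §3). [cite: NeukirchSchmidtWingberg2008, XII §1 (12.1.9)] -/
theorem axD_stabilizer_inf (A : ValuationSubring (AlgebraicClosure K)) (hA : A ≠ ⊤)
    (W : Subgroup (absoluteGaloisGroup K)) (hW : IsOpen (W : Set (absoluteGaloisGroup K)))
    (hWμ : ∀ σ ∈ W, ∀ z : MuCarrier K ℓ, mu K ℓ σ z = z)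
    (f g : absoluteGaloisGroup K → absoluteGaloisGroup K → ZMod ℓ)
    (hflc : IsLocallyConstant
      (fun q : ↥(MulAction.stabilizer (absoluteGaloisGroup K) A ⊓ W) ×
        ↥(MulAction.stabilizer (absoluteGaloisGroup K) A ⊓ W) => f q.1 q.2))
    (hfcoc : ∀ a ∈ MulAction.stabilizer (absoluteGaloisGroup K) A ⊓ W,
      ∀ b ∈ MulAction.stabilizer (absoluteGaloisGroup K) A ⊓ W,
      ∀ c ∈ MulAction.stabilizer (absoluteGaloisGroup K) A ⊓ W,
        f a b + f (a * b) c = f b c + f a (b * c))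
    (hglc : IsLocallyConstant
      (fun q : ↥(MulAction.stabilizer (absoluteGaloisGroup K) A ⊓ W) ×
        ↥(MulAction.stabilizer (absoluteGaloisGroup K) A ⊓ W) => g q.1 q.2))
    (hgcoc : ∀ a ∈ MulAction.stabilizer (absoluteGaloisGroup K) A ⊓ W,
      ∀ b ∈ MulAction.stabilizer (absoluteGaloisGroup K) A ⊓ W,
      ∀ c ∈ MulAction.stabilizer (absoluteGaloisGroup K) A ⊓ W,
        g a b + g (a * b) c = g b c + g a (b * c))
    (hf : ¬ ∃ β : absoluteGaloisGroup K → ZMod ℓ,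
      IsLocallyConstant (fun s : ↥(MulAction.stabilizer (absoluteGaloisGroup K) A ⊓ W) => β s) ∧
        ∀ a ∈ MulAction.stabilizer (absoluteGaloisGroup K) A ⊓ W,
          ∀ b ∈ MulAction.stabilizer (absoluteGaloisGroup K) A ⊓ W, f a b = β a + β b - β (a * b)) :
    ∃ c : ZMod ℓ, ∃ β : absoluteGaloisGroup K → ZMod ℓ,
      IsLocallyConstant (fun s : ↥(MulAction.stabilizer (absoluteGaloisGroup K) A ⊓ W) => β s) ∧
        ∀ a ∈ MulAction.stabilizer (absoluteGaloisGroup K) A ⊓ W,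
          ∀ b ∈ MulAction.stabilizer (absoluteGaloisGroup K) A ⊓ W,
            (g a b - c * f a b) = β a + β b - β (a * b) := by
  obtain ⟨v, σ, φ, hinj, hcont, hrange, hφι⟩ := exists_localEmbedding K A hA
  haveI : CharZero (v.adicCompletion K) := LocalField.charZero_adicCompletion v
  obtain ⟨M, hMfin, hMU⟩ := exists_galFixing_eq_comap hcont W hW
  haveI := hMfin
  obtain ⟨e, he⟩ := exists_continuousMulEquiv_comap hinj hcont hrange W hW
  have hM : ∀ u ∈ galFixing (v.adicCompletion K) M, ∀ z : MuCarrier (v.adicCompletion K) ℓ,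
      mu (v.adicCompletion K) ℓ u z = z := by
    rw [hMU]; exact mu_apply_eq_self_comap hφι W hWμ
  -- pull back `f`, `g` along `φ`
  obtain ⟨hfφlc, hfφcoc⟩ := pullback_lc_coc K hrange e he f hflc hfcoc
  obtain ⟨hgφlc, hgφcoc⟩ := pullback_lc_coc K hrange e he g hglc hgcoc
  have hfφ : ¬ ∃ β : absoluteGaloisGroup (v.adicCompletion K) → ZMod ℓ,
      IsLocallyConstant (fun s : ↥(W.comap φ) => β s) ∧
        ∀ a ∈ W.comap φ, ∀ b ∈ W.comap φ, f (φ a) (φ b) = β a + β b - β (a * b) := by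
    rintro ⟨βG, hβG, hcobG⟩
    apply hf
    exact coboundaryOn_of_coboundary (MulAction.stabilizer (absoluteGaloisGroup K) A ⊓ W) e
      (d := fun a b : ↥(W.comap φ) => f (φ a) (φ b)) (f := f) (fun a b => by rw [he, he])
      (β' := fun s : ↥(W.comap φ) => βG s) hβG
      (fun a b => by
        have := hcobG _ a.2 _ b.2
        rwa [← Subgroup.coe_mul] at this)
  -- the local axiom on `Gal(\bar K_v / M) = φ⁻¹(W)`
  have hloc := exists_sub_mul_coboundary (v.adicCompletion K) M hM
    (fun a b => f (φ a) (φ b)) (fun a b => g (φ a) (φ b))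
  rw [hMU] at hloc
  obtain ⟨c, βG, hβG, hdiff⟩ := hloc hfφlc hfφcoc hgφlc hgφcoc hfφ
  -- push forward
  refine ⟨c, coboundaryOn_of_coboundary (MulAction.stabilizer (absoluteGaloisGroup K) A ⊓ W) e
    (d := fun a b : ↥(W.comap φ) => g (φ a) (φ b) - c * f (φ a) (φ b))
    (f := fun x y => g x y - c * f x y) (fun a b => by simp only [he])
    (β' := fun s : ↥(W.comap φ) => βG s) hβG (fun a b => ?_)⟩
  have := hdiff _ a.2 _ b.2
  rwa [← Subgroup.coe_mul] at this

/-- **(AxLv) at `D_A ∩ W`**: with `A`, `W` as above and an open `W' ≤ W` with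
`ℓ ∣ [D_A ∩ W : D_A ∩ W']`, every explicit cocycle on `D_A ∩ W` bounds on `D_A ∩ W'` — restriction
`H²(Gal(\bar K_v/M), ℤ/ℓ) → H²(Gal(\bar K_v/M'), ℤ/ℓ)` vanishes when `ℓ ∣ [M' : M]` (Serre *Local
Fields* XIII §3 Prop. 7). [cite: NeukirchSchmidtWingberg2008, XII §1 (12.1.9)] -/
theorem axLv_stabilizer_inf (A : ValuationSubring (AlgebraicClosure K)) (hA : A ≠ ⊤)
    (W W' : Subgroup (absoluteGaloisGroup K)) (hW : IsOpen (W : Set (absoluteGaloisGroup K)))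
    (hW' : IsOpen (W' : Set (absoluteGaloisGroup K)))
    (hWμ : ∀ σ ∈ W, ∀ z : MuCarrier K ℓ, mu K ℓ σ z = z) (hW'W : W' ≤ W)
    (hdvd : ℓ ∣ (MulAction.stabilizer (absoluteGaloisGroup K) A ⊓ W').relIndex
      (MulAction.stabilizer (absoluteGaloisGroup K) A ⊓ W))
    (f : absoluteGaloisGroup K → absoluteGaloisGroup K → ZMod ℓ)
    (hflc : IsLocallyConstant
      (fun q : ↥(MulAction.stabilizer (absoluteGaloisGroup K) A ⊓ W) ×
        ↥(MulAction.stabilizer (absoluteGaloisGroup K) A ⊓ W) => f q.1 q.2))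
    (hfcoc : ∀ a ∈ MulAction.stabilizer (absoluteGaloisGroup K) A ⊓ W,
      ∀ b ∈ MulAction.stabilizer (absoluteGaloisGroup K) A ⊓ W,
      ∀ c ∈ MulAction.stabilizer (absoluteGaloisGroup K) A ⊓ W,
        f a b + f (a * b) c = f b c + f a (b * c)) :
    ∃ β : absoluteGaloisGroup K → ZMod ℓ,
      IsLocallyConstant (fun s : ↥(MulAction.stabilizer (absoluteGaloisGroup K) A ⊓ W') => β s) ∧
        ∀ a ∈ MulAction.stabilizer (absoluteGaloisGroup K) A ⊓ W',
          ∀ b ∈ MulAction.stabilizer (absoluteGaloisGroup K) A ⊓ W', f a b = β a + β b - β (a * b) := by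
  obtain ⟨v, σ, φ, hinj, hcont, hrange, hφι⟩ := exists_localEmbedding K A hA
  haveI : CharZero (v.adicCompletion K) := LocalField.charZero_adicCompletion v
  obtain ⟨M, hMfin, hMU⟩ := exists_galFixing_eq_comap hcont W hW
  obtain ⟨M', hM'fin, hM'U'⟩ := exists_galFixing_eq_comap hcont W' hW'
  haveI := hMfin
  haveI := hM'fin
  obtain ⟨e, he⟩ := exists_continuousMulEquiv_comap hinj hcont hrange W hW
  obtain ⟨e', he'⟩ := exists_continuousMulEquiv_comap hinj hcont hrange W' hW'
  have hM : ∀ u ∈ galFixing (v.adicCompletion K) M, ∀ z : MuCarrier (v.adicCompletion K) ℓ,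
      mu (v.adicCompletion K) ℓ u z = z := by
    rw [hMU]; exact mu_apply_eq_self_comap hφι W hWμ
  have hMM' : M ≤ M' := le_of_galFixing_le (v.adicCompletion K)
    (by rw [hMU, hM'U']; exact Subgroup.comap_mono hW'W)
  have hnd : ℓ ∣ (galFixing (v.adicCompletion K) M').relIndex (galFixing (v.adicCompletion K) M) := by
    rw [hMU, hM'U', relIndex_comap_eq hinj hrange]; exact hdvd
  obtain ⟨hfφlc, hfφcoc⟩ := pullback_lc_coc K hrange e he f hflc hfcoc
  have hloc := coboundary_of_dvd_relIndex (v.adicCompletion K) M hM M' hMM' hnd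
    (fun a b => f (φ a) (φ b))
  rw [hMU, hM'U'] at hloc
  obtain ⟨βG, hβG, hcobG⟩ := hloc hfφlc hfφcoc
  exact coboundaryOn_of_coboundary (MulAction.stabilizer (absoluteGaloisGroup K) A ⊓ W') e'
    (d := fun a b : ↥(W'.comap φ) => f (φ a) (φ b)) (f := f) (fun a b => by rw [he', he'])
    (β' := fun s : ↥(W'.comap φ) => βG s) hβG
    (fun a b => by
      have := hcobG _ a.2 _ b.2
      rwa [← Subgroup.coe_mul] at this)

/-- **(AxLi) at `D_A ∩ W`**: with `A`, `W`, `W'` as in `axLv_stabilizer_inf` but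
`ℓ ∤ [D_A ∩ W : D_A ∩ W']`, an explicit cocycle on `D_A ∩ W` which bounds on `D_A ∩ W'` bounds on
`D_A ∩ W` — restriction is injective in degree prime to `ℓ` (`Cor ∘ Res = [M' : M]`, Serre *Galois
Cohomology* I §2.4). [cite: NeukirchSchmidtWingberg2008, XII §1 (12.1.9)] -/
theorem axLi_stabilizer_inf (A : ValuationSubring (AlgebraicClosure K)) (hA : A ≠ ⊤)
    (W W' : Subgroup (absoluteGaloisGroup K)) (hW : IsOpen (W : Set (absoluteGaloisGroup K)))
    (hW' : IsOpen (W' : Set (absoluteGaloisGroup K)))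
    (hWμ : ∀ σ ∈ W, ∀ z : MuCarrier K ℓ, mu K ℓ σ z = z) (hW'W : W' ≤ W)
    (hnd : ¬ ℓ ∣ (MulAction.stabilizer (absoluteGaloisGroup K) A ⊓ W').relIndex
      (MulAction.stabilizer (absoluteGaloisGroup K) A ⊓ W))
    (f : absoluteGaloisGroup K → absoluteGaloisGroup K → ZMod ℓ)
    (hflc : IsLocallyConstant
      (fun q : ↥(MulAction.stabilizer (absoluteGaloisGroup K) A ⊓ W) ×
        ↥(MulAction.stabilizer (absoluteGaloisGroup K) A ⊓ W) => f q.1 q.2))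
    (hfcoc : ∀ a ∈ MulAction.stabilizer (absoluteGaloisGroup K) A ⊓ W,
      ∀ b ∈ MulAction.stabilizer (absoluteGaloisGroup K) A ⊓ W,
      ∀ c ∈ MulAction.stabilizer (absoluteGaloisGroup K) A ⊓ W,
        f a b + f (a * b) c = f b c + f a (b * c))
    (hcob : ∃ β : absoluteGaloisGroup K → ZMod ℓ,
      IsLocallyConstant (fun s : ↥(MulAction.stabilizer (absoluteGaloisGroup K) A ⊓ W') => β s) ∧
        ∀ a ∈ MulAction.stabilizer (absoluteGaloisGroup K) A ⊓ W',
          ∀ b ∈ MulAction.stabilizer (absoluteGaloisGroup K) A ⊓ W', f a b = β a + β b - β (a * b)) :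
    ∃ β : absoluteGaloisGroup K → ZMod ℓ,
      IsLocallyConstant (fun s : ↥(MulAction.stabilizer (absoluteGaloisGroup K) A ⊓ W) => β s) ∧
        ∀ a ∈ MulAction.stabilizer (absoluteGaloisGroup K) A ⊓ W,
          ∀ b ∈ MulAction.stabilizer (absoluteGaloisGroup K) A ⊓ W, f a b = β a + β b - β (a * b) := by
  obtain ⟨v, σ, φ, hinj, hcont, hrange, hφι⟩ := exists_localEmbedding K A hA
  haveI : CharZero (v.adicCompletion K) := LocalField.charZero_adicCompletion v
  obtain ⟨M, hMfin, hMU⟩ := exists_galFixing_eq_comap hcont W hW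
  obtain ⟨M', hM'fin, hM'U'⟩ := exists_galFixing_eq_comap hcont W' hW'
  haveI := hMfin
  haveI := hM'fin
  obtain ⟨e, he⟩ := exists_continuousMulEquiv_comap hinj hcont hrange W hW
  obtain ⟨e', he'⟩ := exists_continuousMulEquiv_comap hinj hcont hrange W' hW'
  have hM : ∀ u ∈ galFixing (v.adicCompletion K) M, ∀ z : MuCarrier (v.adicCompletion K) ℓ,
      mu (v.adicCompletion K) ℓ u z = z := by
    rw [hMU]; exact mu_apply_eq_self_comap hφι W hWμ
  have hMM' : M ≤ M' := le_of_galFixing_le (v.adicCompletion K)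
    (by rw [hMU, hM'U']; exact Subgroup.comap_mono hW'W)
  have hnd' : ¬ ℓ ∣ (galFixing (v.adicCompletion K) M').relIndex (galFixing (v.adicCompletion K) M) := by
    rw [hMU, hM'U', relIndex_comap_eq hinj hrange]; exact hnd
  obtain ⟨hfφlc, hfφcoc⟩ := pullback_lc_coc K hrange e he f hflc hfcoc
  -- the hypothesis, pulled back to `φ⁻¹(W')`
  obtain ⟨β, hβ, hcobβ⟩ := hcob
  have hcobG : ∃ βG : absoluteGaloisGroup (v.adicCompletion K) → ZMod ℓ,
      IsLocallyConstant (fun s : ↥(W'.comap φ) => βG s) ∧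
        ∀ a ∈ W'.comap φ, ∀ b ∈ W'.comap φ, f (φ a) (φ b) = βG a + βG b - βG (a * b) := by
    refine ⟨fun y => β (φ y), ?_, fun a ha b hb => ?_⟩
    · have heq : (fun s : ↥(W'.comap φ) => β (φ s)) =
          (fun t : ↥(MulAction.stabilizer (absoluteGaloisGroup K) A ⊓ W') => β t) ∘ e' := by
        funext s; simp only [Function.comp_apply, he']
      rw [heq]
      exact hβ.comp_continuous e'.continuous
    · show f (φ a) (φ b) = β (φ a) + β (φ b) - β (φ (a * b))
      rw [map_mul]
      exact hcobβ _ (map_mem_stabilizer_inf K hrange ha) _ (map_mem_stabilizer_inf K hrange hb)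
  have hloc := coboundary_of_coboundary_of_not_dvd_relIndex (v.adicCompletion K) M hM M' hMM' hnd'
    (fun a b => f (φ a) (φ b))
  rw [hMU, hM'U'] at hloc
  obtain ⟨βG, hβG, hcobG'⟩ := hloc hfφlc hfφcoc hcobG
  exact coboundaryOn_of_coboundary (MulAction.stabilizer (absoluteGaloisGroup K) A ⊓ W) e
    (d := fun a b : ↥(W.comap φ) => f (φ a) (φ b)) (f := f) (fun a b => by rw [he, he])
    (β' := fun s : ↥(W.comap φ) => βG s) hβG
    (fun a b => by
      have := hcobG' _ a.2 _ b.2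
      rwa [← Subgroup.coe_mul] at this)

end Axioms

end Literature.NumberTheory.GaloisRepresentations.ExplicitMuCocycles

end
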